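import Summits.NavierStokesRegularity.NavierStokesRegularity.Theorems.ExtremiserTransienceNearExtremalTransienceExtremiserLiouvilleConstantSpeedFarCaccioppoli
import Summits.NavierStokesRegularity.NavierStokesRegularity.Theorems.ExtremiserTransienceNearExtremalTransienceExtremiserLiouvilleConstantSpeedStretching
import Literature.Analysis.FluidPDE.WholeSpaceIBPIntegrable
import Literature.Analysis.FluidPDE.LagrangianTimeDerivativeTools
import HarnessLib

/-!
# Crux `ExtremiserTransience.NearExtremalTransience` (stmt-NavierStokesRegularity-21883), line `extremiser_liouville`,
# stub K1b — the CROSS TERMS of the far-field Caccioppoli inequality (1/2): the enstrophy and stretching cross terms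

`--supports stmt-NavierStokesRegularity-21883` (helper).  Author: prover seat `ns-el-k1b` (g7).  Bounds for the four error
terms of `…ConstantSpeedFarCaccioppoli.farCaccioppoli_of_gradient_corrector` in terms of the WEIGHTS `‖Dθ‖`, `‖D∇θ‖` of the
cut-off (`V = v − c`, `ω = curl v`, `F = |Dω|²_F`):

* `integral_crossEnstrophy_eq` — the enstrophy cross term is QUADRATIC in `V` with second derivatives of `θ`:
  `A_× = ∫⟪ω, ∇θ × V⟫ = ∫⟪(D∇θ)V, V⟫ − ½∫‖V‖²·div ∇θ` (Lamb's identity `⟪∇θ × V, ω⟫ = ⟪V, DV∇θ⟫ − ⟪∇θ, DV V⟫` and two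
  integrations by parts); hence `abs_integral_crossEnstrophy_le`: `|A_×| ≤ (5/2)∫‖D∇θ‖‖V‖²` — NO enstrophy factor, so with
  `‖D∇θ‖ ≲ R⁻²` on a region of energy `≲ E₀R` it is `O(E₀/R)` (the Cauchy–Schwarz bound `R⁻¹√(E₀R)√Z` was only `O(R^{-1/2})`);
* `abs_integral_crossStretching_le` — `|J_×| ≤ σ∫‖Dθ‖(‖Dv‖² + 2‖ω‖²)` (`σ ≥ ‖V‖` on `tsupport θ`);
The palinstrophy cross term `C_×`, the pressure-Hessian term and the assembled inequality are in the companion file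
`…ConstantSpeedCrossTermsAssembly`.  With `‖Dθ‖ ≲ R⁻¹`, `‖D∇θ‖ ≲ R⁻²` on a transition region carrying energy
`∫‖V‖² ≲ E₀R`, every term is `O(1/R) + O(η)`.

WHAT THIS IS NOT: K1b is NOT proved; nothing here proves NS regularity. [folklore]
-/

noncomputable section

open Set Filter Topology MeasureTheory Metric Function Real
open scoped ENNReal NNReal Topology InnerProductSpace RealInnerProductSpace ContDiff
open Literature.Analysis.FluidPDE Literature.Analysis

namespace Summit.NavierStokesRegularity.NavierStokesRegularity.Theorems

-- the problem directory repeats the summit name (`NavierStokesRegularity/NavierStokesRegularity`)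
set_option linter.dupNamespace false

namespace ExtremiserLiouville

open DepletionLadder.KStar DepletionLadder.KStar.HalfSpace

variable {v : E3 → E3} {c : E3} {θ : E3 → ℝ}

/-! ## 0. Small tools -/

/-- `‖∇θ x‖ = ‖Dθ x‖`. [folklore] -/
theorem norm_gradient_eq_norm_fderiv (θ : E3 → ℝ) (x : E3) : ‖gradient θ x‖ = ‖fderiv ℝ θ x‖ := by
  rw [gradient]
  exact (InnerProductSpace.toDual ℝ E3).symm.norm_map _

/-- `|div u x| ≤ 3‖Du x‖` on `ℝ³` (trace against an orthonormal basis). [folklore] -/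
theorem abs_divergence_le_three_mul_norm_fderiv (u : E3 → E3) (x : E3) :
    |VectorCalculus.divergence u x| ≤ 3 * ‖fderiv ℝ u x‖ := by
  set b := EuclideanSpace.basisFun (Fin 3) ℝ with hb
  rw [divergence_eq_sum_inner_fderiv b u x]
  have hb1 : ∀ i, ‖b i‖ = 1 := fun i => b.orthonormal.1 i
  have hterm : ∀ i, |⟪b i, fderiv ℝ u x (b i)⟫| ≤ ‖fderiv ℝ u x‖ := fun i => by
    calc |⟪b i, fderiv ℝ u x (b i)⟫| ≤ ‖b i‖ * ‖fderiv ℝ u x (b i)‖ := abs_real_inner_le_norm _ _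
      _ ≤ ‖b i‖ * (‖fderiv ℝ u x‖ * ‖b i‖) := by gcongr; exact (fderiv ℝ u x).le_opNorm _
      _ = ‖fderiv ℝ u x‖ := by rw [hb1 i]; ring
  calc |∑ i, ⟪b i, fderiv ℝ u x (b i)⟫| ≤ ∑ i, |⟪b i, fderiv ℝ u x (b i)⟫| := Finset.abs_sum_le_sum_abs _ _
    _ ≤ ∑ _i : Fin 3, ‖fderiv ℝ u x‖ := Finset.sum_le_sum fun i _ => hterm i
    _ = 3 * ‖fderiv ℝ u x‖ := by simp [Finset.sum_const, Finset.card_univ, Fintype.card_fin]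

/-- `‖a × b‖ ≤ ‖a‖‖b‖` (private copy of the tree lemma). [folklore] -/
private theorem norm_cross_le' (a b : E3) : ‖cross a b‖ ≤ ‖a‖ * ‖b‖ := norm_cross_le a b

/-! ## 1. The enstrophy cross term `A_× = ∫⟪ω, ∇θ × V⟫` is quadratic in `V` -/

/-- **`∫⟪ω, ∇θ × (v − c)⟫ = ∫⟪(D∇θ)(v − c), v − c⟫ − ½∫‖v − c‖²·div ∇θ`** for `v ∈ C^∞` divergence free and `θ ∈ C^∞_c`
(Lamb: `⟪∇θ × V, curl V⟫ = ⟪V, DV ∇θ⟫ − ⟪∇θ, DV V⟫`; then `∫⟪V, DV∇θ⟫ = ½∫⟪∇‖V‖², ∇θ⟫ = −½∫‖V‖² div∇θ` and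
`∫⟪∇θ, DV V⟫ = −∫⟪(D∇θ)V, V⟫` by the divergence theorem for `½‖V‖²∇θ` and `⟪∇θ,V⟫V`). [folklore] -/
theorem integral_crossEnstrophy_eq (hv : ContDiff ℝ ∞ v) (hdiv : VectorCalculus.IsDivFree v)
    (hθ : ContDiff ℝ ∞ θ) (hθc : HasCompactSupport θ) :
    (∫ x, ⟪curl v x, cross (gradient θ x) (v x - c)⟫) =
      (∫ x, ⟪fderiv ℝ (gradient θ) x (v x - c), v x - c⟫) -
        (1 / 2 : ℝ) * ∫ x, ‖v x - c‖ ^ 2 * VectorCalculus.divergence (gradient θ) x := by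
  set V : E3 → E3 := fun y => v y - c with hVdef
  have hV : ContDiff ℝ ∞ V := hv.sub contDiff_const
  have hV1 : ContDiff ℝ 1 V := hV.of_le (by norm_cast)
  have hVd : Differentiable ℝ V := hV1.differentiable one_ne_zero
  have hDV : ∀ x, fderiv ℝ V x = fderiv ℝ v x := fun x => by simp only [hVdef]; rw [fderiv_sub_const]
  have hcurlV : curl V = curl v := curl_sub_const v c
  have hVdiv : VectorCalculus.IsDivFree V := isDivFree_sub_const hdiv c
  have hg : ContDiff ℝ ∞ (gradient θ) := contDiff_gradient_top hθ
  have hg1 : ContDiff ℝ 1 (gradient θ) := hg.of_le (by norm_cast)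
  have hgd : Differentiable ℝ (gradient θ) := hg1.differentiable one_ne_zero
  have hgc : HasCompactSupport (gradient θ) := hasCompactSupport_gradient hθc
  -- (a) Lamb, pointwise
  have hpt : ∀ x, ⟪curl v x, cross (gradient θ x) (V x)⟫ =
      ⟪V x, fderiv ℝ v x (gradient θ x)⟫ - ⟪gradient θ x, fderiv ℝ v x (V x)⟫ := by
    intro x
    rw [real_inner_comm, ← hcurlV, inner_cross_curl (gradient θ x) (V x) V x, hDV]
  -- (b) `∫⟪V, Dv ∇θ⟫ = −½∫‖V‖² div ∇θ`
  set f : E3 → ℝ := fun y => (1 / 2 : ℝ) * ‖V y‖ ^ 2 with hfdef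
  have hf1 : ContDiff ℝ 1 f := contDiff_const.mul ((hV1.norm_sq ℝ))
  have hDf : ∀ x, fderiv ℝ f x (gradient θ x) = ⟪V x, fderiv ℝ v x (gradient θ x)⟫ := by
    intro x
    have h : HasFDerivAt f ((1 / 2 : ℝ) • ((2 : ℕ) • ((innerSL ℝ (V x)).comp (fderiv ℝ V x)))) x :=
      ((hVd x).hasFDerivAt.norm_sq).const_mul (1 / 2 : ℝ)
    rw [h.fderiv, FunLike.coe_smul, Pi.smul_apply, FunLike.coe_smul, Pi.smul_apply, ContinuousLinearMap.comp_apply,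
      innerSL_apply_apply, hDV, smul_eq_mul, nsmul_eq_mul]
    push_cast
    ring
  have hb : (∫ x, ⟪V x, fderiv ℝ v x (gradient θ x)⟫) =
      -((1 / 2 : ℝ) * ∫ x, ‖V x‖ ^ 2 * VectorCalculus.divergence (gradient θ) x) := by
    have h := integral_mul_divergence_add_eq_zero_right hf1 hg1 hgc
    -- `∫ f div ∇θ + ∫⟪∇θ, ∇f⟫ = 0`
    have e1 : (∫ x, ⟪gradient θ x, gradient f x⟫) = ∫ x, ⟪V x, fderiv ℝ v x (gradient θ x)⟫ := by
      refine integral_congr_ae (Eventually.of_forall fun x => ?_)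
      show ⟪gradient θ x, gradient f x⟫ = ⟪V x, fderiv ℝ v x (gradient θ x)⟫
      rw [real_inner_comm, gradient, InnerProductSpace.toDual_symm_apply, hDf x]
    have e2 : (∫ x, f x * VectorCalculus.divergence (gradient θ) x) =
        (1 / 2 : ℝ) * ∫ x, ‖V x‖ ^ 2 * VectorCalculus.divergence (gradient θ) x := by
      rw [← integral_const_mul]
      refine integral_congr_ae (Eventually.of_forall fun x => ?_)
      show f x * _ = _
      simp only [hfdef]; ring
    rw [e1, e2] at h
    linarith
  -- (c) `∫⟪∇θ, Dv V⟫ = −∫⟪(D∇θ)V, V⟫`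
  have hc' : (∫ x, ⟪gradient θ x, fderiv ℝ v x (V x)⟫) = -∫ x, ⟪fderiv ℝ (gradient θ) x (V x), V x⟫ := by
    set g : E3 → ℝ := fun y => ⟪gradient θ y, V y⟫ with hgdef
    have hg1' : ContDiff ℝ 1 g := hg1.inner ℝ hV1
    have hgc' : HasCompactSupport g := by
      refine hgc.mono fun x hx => ?_
      simp only [hgdef, mem_support, ne_eq] at hx ⊢
      intro h0; exact hx (by rw [h0, inner_zero_left])
    have hY1 : ContDiff ℝ 1 (fun y => g y • V y) := hg1'.smul hV1
    have hYc : HasCompactSupport (fun y => g y • V y) := hgc'.smul_right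
    have h0 := integral_divergence_eq_zero hY1 hYc
    have hpt' : ∀ x, VectorCalculus.divergence (fun y => g y • V y) x =
        ⟪gradient θ x, fderiv ℝ v x (V x)⟫ + ⟪fderiv ℝ (gradient θ) x (V x), V x⟫ := by
      intro x
      rw [divergence_smul_apply (hg1'.differentiable one_ne_zero x) (hVd x), hVdiv x, mul_zero, zero_add,
        real_inner_comm, gradient, InnerProductSpace.toDual_symm_apply]
      show fderiv ℝ (fun y => ⟪gradient θ y, V y⟫) x (V x) = _
      rw [fderiv_inner_apply ℝ (hgd x) (hVd x), hDV]
    simp_rw [hpt'] at h0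
    have cV : Continuous V := hV.continuous
    have i1 : Integrable (fun x => ⟪gradient θ x, fderiv ℝ v x (V x)⟫) volume :=
      integrable_inner_of_hasCompactSupport_left hg.continuous ((hv.continuous_fderiv (by simp)).clm_apply cV) hgc
    have i2 : Integrable (fun x => ⟪fderiv ℝ (gradient θ) x (V x), V x⟫) volume := by
      refine integrable_inner_of_hasCompactSupport_left ((hg.continuous_fderiv (by simp)).clm_apply cV) cV ?_
      refine (hgc.fderiv (𝕜 := ℝ)).mono fun x hx => ?_
      simp only [mem_support, ne_eq] at hx ⊢
      intro h0; exact hx (by rw [h0, _root_.zero_apply])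
    rw [integral_add i1 i2] at h0
    linarith
  -- assemble
  have cV : Continuous V := hV.continuous
  have i3 : Integrable (fun x => ⟪V x, fderiv ℝ v x (gradient θ x)⟫) volume :=
    integrable_inner_of_hasCompactSupport_right cV ((hv.continuous_fderiv (by simp)).clm_apply hg.continuous)
      (by
        refine hgc.mono fun x hx => ?_
        simp only [mem_support, ne_eq] at hx ⊢
        intro h0; exact hx (by rw [h0, map_zero]))
  have i4 : Integrable (fun x => ⟪gradient θ x, fderiv ℝ v x (V x)⟫) volume :=
    integrable_inner_of_hasCompactSupport_left hg.continuous ((hv.continuous_fderiv (by simp)).clm_apply cV) hgc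
  calc (∫ x, ⟪curl v x, cross (gradient θ x) (v x - c)⟫)
      = ∫ x, (⟪V x, fderiv ℝ v x (gradient θ x)⟫ - ⟪gradient θ x, fderiv ℝ v x (V x)⟫) :=
        integral_congr_ae (Eventually.of_forall hpt)
    _ = (∫ x, ⟪V x, fderiv ℝ v x (gradient θ x)⟫) - ∫ x, ⟪gradient θ x, fderiv ℝ v x (V x)⟫ := integral_sub i3 i4
    _ = _ := by rw [hb, hc']; ring

/-- **`|A_×| ≤ (5/2)∫‖D∇θ‖·‖v − c‖²`** (from `integral_crossEnstrophy_eq` and `|div ∇θ| ≤ 3‖D∇θ‖`). [folklore] -/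
theorem abs_integral_crossEnstrophy_le (hv : ContDiff ℝ ∞ v) (hdiv : VectorCalculus.IsDivFree v)
    (hθ : ContDiff ℝ ∞ θ) (hθc : HasCompactSupport θ) :
    |∫ x, ⟪curl v x, cross (gradient θ x) (v x - c)⟫| ≤
      (5 / 2 : ℝ) * ∫ x, ‖fderiv ℝ (gradient θ) x‖ * ‖v x - c‖ ^ 2 := by
  rw [integral_crossEnstrophy_eq hv hdiv hθ hθc]
  have hV : ContDiff ℝ ∞ (fun y => v y - c) := hv.sub contDiff_const
  have cV : Continuous (fun y => v y - c) := hV.continuous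
  have hg : ContDiff ℝ ∞ (gradient θ) := contDiff_gradient_top hθ
  have hgc : HasCompactSupport (gradient θ) := hasCompactSupport_gradient hθc
  have cDg : Continuous (fderiv ℝ (gradient θ)) := hg.continuous_fderiv (by simp)
  have hDgc : HasCompactSupport (fderiv ℝ (gradient θ)) := hgc.fderiv (𝕜 := ℝ)
  -- the weight integral
  have iw : Integrable (fun x => ‖fderiv ℝ (gradient θ) x‖ * ‖v x - c‖ ^ 2) volume :=
    (cDg.norm.mul (cV.norm.pow 2)).integrable_of_hasCompactSupport (hDgc.norm.mul_right)
  -- first piece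
  have h1 : |∫ x, ⟪fderiv ℝ (gradient θ) x (v x - c), v x - c⟫| ≤ ∫ x, ‖fderiv ℝ (gradient θ) x‖ * ‖v x - c‖ ^ 2 := by
    rw [← Real.norm_eq_abs]
    refine norm_integral_le_of_norm_le iw (Eventually.of_forall fun x => ?_)
    rw [Real.norm_eq_abs]
    calc |⟪fderiv ℝ (gradient θ) x (v x - c), v x - c⟫| ≤ ‖fderiv ℝ (gradient θ) x (v x - c)‖ * ‖v x - c‖ :=
          abs_real_inner_le_norm _ _
      _ ≤ (‖fderiv ℝ (gradient θ) x‖ * ‖v x - c‖) * ‖v x - c‖ := by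
          gcongr; exact (fderiv ℝ (gradient θ) x).le_opNorm _
      _ = ‖fderiv ℝ (gradient θ) x‖ * ‖v x - c‖ ^ 2 := by ring
  -- second piece
  have h2 : |∫ x, ‖v x - c‖ ^ 2 * VectorCalculus.divergence (gradient θ) x| ≤
      3 * ∫ x, ‖fderiv ℝ (gradient θ) x‖ * ‖v x - c‖ ^ 2 := by
    rw [← Real.norm_eq_abs, ← integral_const_mul]
    refine norm_integral_le_of_norm_le (iw.const_mul 3) (Eventually.of_forall fun x => ?_)
    rw [Real.norm_eq_abs, abs_mul, abs_of_nonneg (sq_nonneg _)]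
    have := abs_divergence_le_three_mul_norm_fderiv (gradient θ) x
    nlinarith [this, sq_nonneg ‖v x - c‖, abs_nonneg (VectorCalculus.divergence (gradient θ) x)]
  calc |(∫ x, ⟪fderiv ℝ (gradient θ) x (v x - c), v x - c⟫) -
        (1 / 2 : ℝ) * ∫ x, ‖v x - c‖ ^ 2 * VectorCalculus.divergence (gradient θ) x|
      ≤ |∫ x, ⟪fderiv ℝ (gradient θ) x (v x - c), v x - c⟫| +
          |(1 / 2 : ℝ) * ∫ x, ‖v x - c‖ ^ 2 * VectorCalculus.divergence (gradient θ) x| := abs_sub _ _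
    _ ≤ (∫ x, ‖fderiv ℝ (gradient θ) x‖ * ‖v x - c‖ ^ 2) + (1 / 2 : ℝ) * (3 * ∫ x, ‖fderiv ℝ (gradient θ) x‖ * ‖v x - c‖ ^ 2) := by
          rw [abs_mul, abs_of_pos (by norm_num : (0:ℝ) < 1 / 2)]
          exact add_le_add h1 (mul_le_mul_of_nonneg_left h2 (by norm_num))
    _ = (5 / 2 : ℝ) * ∫ x, ‖fderiv ℝ (gradient θ) x‖ * ‖v x - c‖ ^ 2 := by ring

/-! ## 2. The stretching cross term `J_×` -/

/-- **`|J_×| ≤ σ∫‖Dθ‖(‖Dv‖² + 2‖ω‖²)`**, `σ ≥ ‖v − c‖` on `tsupport θ` (pointwise `|J_×-integrand| ≤ σ‖Dθ‖(2‖Dv‖‖ω‖ + ‖ω‖²)`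
and `2ab ≤ a² + b²`). [folklore] -/
theorem abs_integral_crossStretching_le (hv : ContDiff ℝ ∞ v) (hθ : ContDiff ℝ ∞ θ) (hθc : HasCompactSupport θ)
    {σ : ℝ} (hσ0 : 0 ≤ σ) (hσ : ∀ x ∈ tsupport θ, ‖v x - c‖ ≤ σ) :
    |∫ x, (⟪cross (gradient θ x) (v x - c), fderiv ℝ v x (curl v x)⟫ +
        (fderiv ℝ θ x (curl v x)) * ⟪curl v x, v x - c⟫ + ⟪curl v x, fderiv ℝ v x (cross (gradient θ x) (v x - c))⟫)| ≤
      σ * ∫ x, ‖fderiv ℝ θ x‖ * (‖fderiv ℝ v x‖ ^ 2 + 2 * ‖curl v x‖ ^ 2) := by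
  have cω : Continuous (curl v) := (contDiff_curl_top hv).continuous
  have cDv : Continuous (fderiv ℝ v) := hv.continuous_fderiv (by simp)
  have cDθ : Continuous (fderiv ℝ θ) := hθ.continuous_fderiv (by simp)
  have hDθc : HasCompactSupport (fderiv ℝ θ) := hθc.fderiv (𝕜 := ℝ)
  have iw : Integrable (fun x => ‖fderiv ℝ θ x‖ * (‖fderiv ℝ v x‖ ^ 2 + 2 * ‖curl v x‖ ^ 2)) volume :=
    (cDθ.norm.mul ((cDv.norm.pow 2).add (continuous_const.mul (cω.norm.pow 2)))).integrable_of_hasCompactSupport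
      hDθc.norm.mul_right
  rw [← Real.norm_eq_abs, ← integral_const_mul]
  refine norm_integral_le_of_norm_le (iw.const_mul σ) (Eventually.of_forall fun x => ?_)
  by_cases hx : x ∈ tsupport θ
  · have hV : ‖v x - c‖ ≤ σ := hσ x hx
    have hg : ‖gradient θ x‖ = ‖fderiv ℝ θ x‖ := norm_gradient_eq_norm_fderiv θ x
    set D := ‖fderiv ℝ θ x‖
    set A := ‖fderiv ℝ v x‖
    set O := ‖curl v x‖
    have hD0 : 0 ≤ D := norm_nonneg _
    have hA0 : 0 ≤ A := norm_nonneg _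
    have hO0 : 0 ≤ O := norm_nonneg _
    have h1 : |⟪cross (gradient θ x) (v x - c), fderiv ℝ v x (curl v x)⟫| ≤ D * σ * (A * O) := by
      calc |⟪cross (gradient θ x) (v x - c), fderiv ℝ v x (curl v x)⟫|
          ≤ ‖cross (gradient θ x) (v x - c)‖ * ‖fderiv ℝ v x (curl v x)‖ := abs_real_inner_le_norm _ _
        _ ≤ (‖gradient θ x‖ * ‖v x - c‖) * (A * O) :=
            mul_le_mul (norm_cross_le' _ _) ((fderiv ℝ v x).le_opNorm _) (norm_nonneg _) (by positivity)
        _ ≤ (D * σ) * (A * O) := by rw [hg]; gcongr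
    have h2 : |(fderiv ℝ θ x (curl v x)) * ⟪curl v x, v x - c⟫| ≤ (D * O) * (O * σ) := by
      rw [abs_mul]
      refine mul_le_mul ?_ ((abs_real_inner_le_norm _ _).trans (by gcongr)) (abs_nonneg _) (by positivity)
      rw [← Real.norm_eq_abs]; exact (fderiv ℝ θ x).le_opNorm _
    have h3 : |⟪curl v x, fderiv ℝ v x (cross (gradient θ x) (v x - c))⟫| ≤ O * (A * (D * σ)) := by
      calc |⟪curl v x, fderiv ℝ v x (cross (gradient θ x) (v x - c))⟫|
          ≤ O * ‖fderiv ℝ v x (cross (gradient θ x) (v x - c))‖ := abs_real_inner_le_norm _ _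
        _ ≤ O * (A * ‖cross (gradient θ x) (v x - c)‖) := by gcongr; exact (fderiv ℝ v x).le_opNorm _
        _ ≤ O * (A * (‖gradient θ x‖ * ‖v x - c‖)) := by gcongr; exact norm_cross_le' _ _
        _ ≤ O * (A * (D * σ)) := by rw [hg]; gcongr
    rw [Real.norm_eq_abs]
    calc |⟪cross (gradient θ x) (v x - c), fderiv ℝ v x (curl v x)⟫ +
          (fderiv ℝ θ x (curl v x)) * ⟪curl v x, v x - c⟫ + ⟪curl v x, fderiv ℝ v x (cross (gradient θ x) (v x - c))⟫|
        ≤ |⟪cross (gradient θ x) (v x - c), fderiv ℝ v x (curl v x)⟫| +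
          |(fderiv ℝ θ x (curl v x)) * ⟪curl v x, v x - c⟫| + |⟪curl v x, fderiv ℝ v x (cross (gradient θ x) (v x - c))⟫| := by
          refine (abs_add_le _ _).trans ?_
          linarith [abs_add_le (⟪cross (gradient θ x) (v x - c), fderiv ℝ v x (curl v x)⟫)
            ((fderiv ℝ θ x (curl v x)) * ⟪curl v x, v x - c⟫)]
      _ ≤ D * σ * (A * O) + (D * O) * (O * σ) + O * (A * (D * σ)) := add_le_add (add_le_add h1 h2) h3
      _ = σ * (D * (2 * (A * O) + O ^ 2)) := by ring
      _ ≤ σ * (D * (A ^ 2 + 2 * O ^ 2)) := by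
          have : 2 * (A * O) ≤ A ^ 2 + O ^ 2 := by nlinarith [sq_nonneg (A - O)]
          have : D * (2 * (A * O) + O ^ 2) ≤ D * (A ^ 2 + 2 * O ^ 2) := by nlinarith [hD0]
          nlinarith [hσ0]
  · have hD : fderiv ℝ θ x = 0 := fderiv_of_notMem_tsupport ℝ hx
    have hg : gradient θ x = 0 := by rw [gradient, hD, map_zero]
    have hc0 : cross (0 : E3) (v x - c) = 0 := by rw [← crossCLM_apply, map_zero]; rfl
    rw [hD, hg, hc0]
    simp

end ExtremiserLiouville

end Summit.NavierStokesRegularity.NavierStokesRegularity.Theorems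

end
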